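import Summits.Ventures.YMGap.YM3IR.DecayTransferProof
import HarnessLib

/-!
# YM₃ infrared statement — the decay transfer under IN-MEAN (L¹) fluctuation hypotheses
# (cell `pub-ymgap`, track Y4; ym3ir-theory-2, «weakest printed-form hypotheses»)

HONEST FRAMING.  Pure probability bookkeeping, NO statement about Yang–Mills: this file re-proves the per-volume
core of the support lemma `DecayTransfer` (tree `DecayTransferProof.decayTransfer_of`, ds-1) under hypotheses that
are WEAKER than the two clauses of the conjecture `FluctuationDecouplingAt r ρ W β κ` (`YM3IR/Statement.lean`):
the ALMOST-SURE bounds in the coarse field `V = blk U` —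
(i) `|condCov(f, g | V)| ≤ c ΣδfΣδg e^{−κn/b}` a.s. and (ii) `|E[f | V] − h_f∘blk| ≤ c Σδf e^{−κR}` a.s. —
are replaced by their INTEGRATED (L¹, «in-mean») forms
(i′) `∫ |condCov(f, g | V)| dμ ≤ c ΣδfΣδg e^{−κn/b}` and (ii′) `∫ |E[f | V] − h_f∘blk| dμ ≤ c Σδf e^{−κR}`.
WHY THIS IS THE WEAKEST FORM THE COMPOSITION USES.  In the law of total covariance
`cov(f,g) = E[condCov] + cov(E[f|V], E[g|V])` only `|E[condCov]| ≤ E|condCov|` enters, and the two cross terms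
`cov(D_f, E[g|V])`, `cov(h_f∘blk, D_g)` (`D_f = E[f|V] − h_f∘blk`) are bounded by `2·E|D|·width`
(`abs_covariance_le_of_integral_abs_le` below, the L¹ form of `CovarianceLemmas.abs_covariance_le_of_abs_le`).
The a.s. clauses quantify over Haar-almost-every coarse field, INCLUDING the rough / large coarse fields where no
small-background expansion is available (Bałaban's regularity condition (3.35) of CMP 99 Thm 3.1 fails there); the
in-mean clauses only ask that such fields carry small probability × bounded integrand — the form a large-field /
small-field split of the measure actually delivers.  The conjecture itself (in either form) is NOT touched here; the
named in-mean predicates and the composition `… ⟹ MassGap3Cofinal` with them are filed separately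
(`YM3IR/InMean.lean`).  WHY THIS IS NOVEL (bookkeeping sense only): it certifies that the YM₃ infrared promise can be
stated with an L¹ fluctuation hypothesis, strictly weaker than the a.s. one of record.  No axiom, no `sorry`, 0 compute.

MECHANISM = that of `DecayTransferProof` verbatim (law of total covariance, quasi-locality at radius `R = ⌊n/(3b)⌋`,
push-forward of `cov(h_f∘blk, h_g∘blk)` to the coarse law, block geometry `CoarseGeometry.le_blockSeparation`), with
the three places that used an a.s. bound now using the L¹ bound; same constant
`A = c₀ + 4c₀D₀e^{κ}(1 + c₀) + A₀c₀²e^{2m_c}` (`c₀ = max c 0`, `D₀ = max D 0`, `A₀ = max A_c 0`) and same rate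
`min(m_c, κ)/(3b)`.

References: H. Föllmer, LNM 1362 (1988) Ch. I (2.17)–(2.22) [cite: Follmer1988]; T. Bałaban, CMP 99 (1985) 389,
Thm 3.1 (perturbative germ of the fluctuation clauses) [cite: Balaban1985BackgroundPropagators]; T. Bałaban,
M. O'Carroll, CMP 199 (1999) 493 (method template only) [cite: BalabanOcarroll1999].
-/

noncomputable section

open MeasureTheory ProbabilityTheory Filter Finset
open Literature.Probability.LatticeModels Literature.Probability.LatticeModels.DobrushinMetric
open Literature.MathematicalPhysics.QuantumLattice Literature.MathematicalPhysics.QuantumFieldTheory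
open Summit.Ventures.YMGap.YM3IR.DecayTransferProof

namespace Summit.Ventures.YMGap.YM3IR.DecayTransferInMean

/-! ### L¹ helpers -/

section Helpers

variable {Ω : Type*} [MeasurableSpace Ω] {μ : Measure Ω}

/-- **L¹ cross-term bound.** On a probability space, if `D` is integrable with `∫ |D| ≤ η` and `a ≤ Y ≤ b` a.e.,
then `|cov(D, Y)| ≤ 2η(b − a)`: `|D − E D| ≤ |D| + η` pointwise and `|Y − E Y| ≤ b − a` a.e.  (The L¹ form of
`CovarianceLemmas.abs_covariance_le_of_abs_le`, which assumed `|D| ≤ η` a.e.) [folklore] -/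
theorem abs_covariance_le_of_integral_abs_le [IsProbabilityMeasure μ] {D Y : Ω → ℝ} (hD : Integrable D μ)
    (hY : AEStronglyMeasurable Y μ) {η a b : ℝ} (hη : ∫ ω, |D ω| ∂μ ≤ η)
    (hab : ∀ᵐ ω ∂μ, a ≤ Y ω ∧ Y ω ≤ b) : |cov[D, Y; μ]| ≤ 2 * η * (b - a) := by
  have hYb : ∀ᵐ ω ∂μ, |Y ω| ≤ max |a| |b| := hab.mono fun ω h => abs_le_max_abs_abs h.1 h.2
  have hYi : Integrable Y μ := (memLp_two_of_ae_bound hY hYb).integrable one_le_two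
  have hmD : |∫ ω, D ω ∂μ| ≤ η := abs_integral_le_integral_abs.trans hη
  have hmY := integral_mem_Icc_of_ae hYi hab
  have hba : 0 ≤ b - a := by linarith [hmY.1, hmY.2]
  have hη0 : 0 ≤ η := (integral_nonneg fun _ => abs_nonneg _).trans hη
  have hpt : ∀ᵐ ω ∂μ, |(D ω - ∫ x, D x ∂μ) * (Y ω - ∫ x, Y x ∂μ)| ≤ (|D ω| + η) * (b - a) := by
    filter_upwards [hab] with ω hω
    rw [abs_mul]
    have h1 : |D ω - ∫ x, D x ∂μ| ≤ |D ω| + η := (abs_sub _ _).trans (add_le_add le_rfl hmD)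
    have h2 : |Y ω - ∫ x, Y x ∂μ| ≤ b - a := by
      rw [abs_le]; constructor <;> linarith [hω.1, hω.2, hmY.1, hmY.2]
    exact mul_le_mul h1 h2 (abs_nonneg _) (add_nonneg (abs_nonneg _) hη0)
  have hint : Integrable (fun ω => (|D ω| + η) * (b - a)) μ := (hD.abs.add (integrable_const η)).mul_const _
  have hadd : ∫ ω, (|D ω| + η) ∂μ = ∫ ω, |D ω| ∂μ + ∫ _, η ∂μ := integral_add hD.abs (integrable_const η)
  calc |cov[D, Y; μ]| = |∫ ω, (D ω - ∫ x, D x ∂μ) * (Y ω - ∫ x, Y x ∂μ) ∂μ| := rfl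
    _ ≤ ∫ ω, |(D ω - ∫ x, D x ∂μ) * (Y ω - ∫ x, Y x ∂μ)| ∂μ := abs_integral_le_integral_abs
    _ ≤ ∫ ω, (|D ω| + η) * (b - a) ∂μ :=
        integral_mono_of_nonneg (Eventually.of_forall fun _ => abs_nonneg _) hint hpt
    _ = (∫ ω, |D ω| ∂μ + η) * (b - a) := by rw [integral_mul_const, hadd]; simp
    _ ≤ (η + η) * (b - a) := mul_le_mul_of_nonneg_right (add_le_add hη le_rfl) hba
    _ = 2 * η * (b - a) := by ring

end Helpers

/-! ### The per-volume decay transfer under in-mean hypotheses -/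

section Main

variable {G : Type} [MeasurableSpace G] {N : ℕ} [Group G] [TopologicalSpace G] [IsTopologicalGroup G]
  [CompactSpace G] [BorelSpace G]

/-- **Decay transfer, in-mean form, at ONE volume.**  Fix a block family `W`, a coupling `β` (block factor
`b = b(β)`), a coarse side `M`, a link weight `r ≤ D`, nonnegative rates `κ, m_c`; suppose the fine Wilson law
`μ = fineLaw ρ β W M` is a probability measure or zero (always true; `InMean.lean` discharges it for continuous `ρ`),
the coarse law `coarseFamily ρ β W M` clusters with `(A_c, m_c)`, and the two IN-MEAN fluctuation clauses hold at
this volume with constant `c`: (i′) `∫ |condCov W β M μ f g| dμ ≤ c ΣδfΣδg e^{−κn/b}` for supports at fine distance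
`≥ n`; (ii′) every `E[f | V]` is within `c Σδf e^{−κR}` IN `L¹(μ)` of a bounded measurable cylinder function
`h∘blk`, `h` supported in `coarseHull b M Δf R` with loads `Σδh ≤ cΣδf`.  Then `μ` clusters with constant
`c₀ + 4c₀D₀e^{κ}(1+c₀) + A₀c₀²e^{2m_c}` at rate `min(m_c, κ)/(3b)`.  Strictly generalises the per-volume content of
`DecayTransferProof.decayTransfer_of` (a.s. bounds ⟹ L¹ bounds on a probability space). [folklore] -/
theorem clustersWith_fine_of_inMean {ρ : G →* Matrix (Fin N) (Fin N) ℂ} {r : G → G → ℝ} {W : BlockFamily G}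
    {β m_c κ D A_c c : ℝ} {M : ℕ} [NeZero M]
    (hP : IsProbabilityMeasure (fineLaw ρ β W M) ∨ fineLaw ρ β W M = 0)
    (hκ : 0 ≤ κ) (hmc : 0 ≤ m_c) (hD : ∀ a b : G, r a b ≤ D)
    (hcoarse : ClustersWith r (coarseFamily ρ β W M) A_c m_c)
    (hfl1 : ∀ (f g : GaugeConfig 3 (W.factor β * M) G → ℝ) (Δf Δg : Finset (Edge 3 (W.factor β * M)))
        (δf δg : Edge 3 (W.factor β * M) → ℝ) (n : ℕ),
      Measurable f → Measurable g → DependsOn f (↑Δf : Set _) → DependsOn g (↑Δg : Set _) →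
      (∃ C, ∀ U, |f U| ≤ C) → (∃ C, ∀ U, |g U| ≤ C) → IsLipBound r f δf → IsLipBound r g δg →
      (∀ x ∈ Δf, ∀ y ∈ Δg, n ≤ torusNorm (x.1 - y.1)) →
        ∫ U, |condCov W β M (fineLaw ρ β W M) f g U| ∂(fineLaw ρ β W M)
          ≤ c * (∑ x ∈ Δf, δf x) * (∑ y ∈ Δg, δg y) * Real.exp (-κ * n / W.factor β))
    (hfl2 : ∀ (f : GaugeConfig 3 (W.factor β * M) G → ℝ) (Δf : Finset (Edge 3 (W.factor β * M)))
        (δf : Edge 3 (W.factor β * M) → ℝ) (R : ℕ),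
      Measurable f → DependsOn f (↑Δf : Set _) → (∃ C, ∀ U, |f U| ≤ C) → IsLipBound r f δf →
      ∃ (h : GaugeConfig 3 M G → ℝ) (Δh : Finset (Edge 3 M)) (δh : Edge 3 M → ℝ),
        Measurable h ∧ DependsOn h (↑Δh : Set _) ∧ (↑Δh : Set _) ⊆ coarseHull (W.factor β) M Δf R ∧
        (∃ C, ∀ V, |h V| ≤ C) ∧ IsLipBound r h δh ∧ (∑ y ∈ Δh, δh y) ≤ c * ∑ x ∈ Δf, δf x ∧
        ∫ U, |condExp (coarseSigma W β M) (fineLaw ρ β W M) f U - h (W.blk β M U)| ∂(fineLaw ρ β W M)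
          ≤ c * (∑ x ∈ Δf, δf x) * Real.exp (-κ * R)) :
    ClustersWith r (fineLaw ρ β W M)
      (max c 0 + 4 * max c 0 * max D 0 * Real.exp κ * (1 + max c 0) + max A_c 0 * max c 0 ^ 2 * Real.exp (2 * m_c))
      (min m_c κ / (3 * W.factor β)) := by
  classical
  -- the block factor and the rate
  have hb : 0 < W.factor β := W.factor_pos β
  have hbR : (0 : ℝ) < (W.factor β : ℝ) := by exact_mod_cast hb
  set m : ℝ := min m_c κ / (3 * (W.factor β : ℝ)) with hm_def
  -- normalised constants
  set c₀ : ℝ := max c 0 with hc₀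
  set D₀ : ℝ := max D 0 with hD₀
  set A₀ : ℝ := max A_c 0 with hA₀
  have hc₀0 : 0 ≤ c₀ := le_max_right _ _
  have hD₀0 : 0 ≤ D₀ := le_max_right _ _
  have hA₀0 : 0 ≤ A₀ := le_max_right _ _
  have hcc₀ : c ≤ c₀ := le_max_left _ _
  intro f g Δf Δg δf δg n hfm hgm hfd hgd hfb hgb hfl' hgl hdist
  -- the constant is nonnegative
  have hA0 : 0 ≤ c₀ + 4 * c₀ * D₀ * Real.exp κ * (1 + c₀) + A₀ * c₀ ^ 2 * Real.exp (2 * m_c) := by positivity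
  -- the fine law is a probability measure (or zero, in which case every covariance vanishes)
  set μ : Measure (GaugeConfig 3 (W.factor β * M) G) := fineLaw ρ β W M with hμ
  have hSf0' : 0 ≤ ∑ x ∈ Δf, δf x := sum_nonneg fun x _ => hfl'.nonneg x
  have hSg0' : 0 ≤ ∑ y ∈ Δg, δg y := sum_nonneg fun y _ => hgl.nonneg y
  rcases hP with hPM | hzero
  swap
  · have hcov : cov[f, g; μ] = 0 := by rw [hzero]; simp [covariance]
    rw [hcov, abs_zero]; positivity
  haveI : IsProbabilityMeasure μ := hPM
  -- the coarse σ-algebra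
  have hmle : coarseSigma W β M ≤ (inferInstance : MeasurableSpace (GaugeConfig 3 (W.factor β * M) G)) :=
    (W.measurable_blk β M).comap_le
  -- sums of loads
  set Sf : ℝ := ∑ x ∈ Δf, δf x with hSf
  set Sg : ℝ := ∑ y ∈ Δg, δg y with hSg
  have hSf0 : 0 ≤ Sf := sum_nonneg fun x _ => hfl'.nonneg x
  have hSg0 : 0 ≤ Sg := sum_nonneg fun y _ => hgl.nonneg y
  obtain ⟨Cf, hCf⟩ := hfb
  obtain ⟨Cg, hCg⟩ := hgb
  -- (1) law of total covariance
  have hLTC := covariance_eq_integral_condCov_add (μ := μ) hmle hfm.aestronglyMeasurable hgm.aestronglyMeasurable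
    (ae_of_all _ hCf) (ae_of_all _ hCg)
  -- (2) the conditional-covariance term, now from the L¹ bound (i′): `|∫ condCov| ≤ ∫ |condCov|`
  have hT1 : |∫ U, ((μ[f * g|coarseSigma W β M]) U - (μ[f|coarseSigma W β M]) U * (μ[g|coarseSigma W β M]) U) ∂μ|
      ≤ c₀ * Sf * Sg * Real.exp (-m * n) := by
    have hmean : ∫ U, |(μ[f * g|coarseSigma W β M]) U - (μ[f|coarseSigma W β M]) U * (μ[g|coarseSigma W β M]) U| ∂μ
        ≤ c * Sf * Sg * Real.exp (-κ * n / W.factor β) :=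
      hfl1 f g Δf Δg δf δg n hfm hgm hfd hgd ⟨Cf, hCf⟩ ⟨Cg, hCg⟩ hfl' hgl hdist
    have hn0 : (0 : ℝ) ≤ n := Nat.cast_nonneg n
    have hexp : Real.exp (-κ * n / W.factor β) ≤ Real.exp (-m * n) := by
      refine Real.exp_le_exp.2 ?_
      have hmk : m ≤ κ / (W.factor β : ℝ) :=
        calc m = min m_c κ / (3 * (W.factor β : ℝ)) := rfl
          _ ≤ κ / (3 * (W.factor β : ℝ)) := div_le_div_of_nonneg_right (min_le_right _ _) (by positivity)
          _ ≤ κ / (W.factor β : ℝ) := div_le_div_of_nonneg_left hκ hbR (by linarith)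
      have h1 : m * n ≤ κ / (W.factor β : ℝ) * n := mul_le_mul_of_nonneg_right hmk hn0
      have e : -κ * (n : ℝ) / (W.factor β : ℝ) = -(κ / (W.factor β : ℝ) * n) := by ring
      rw [e]; linarith
    calc |∫ U, ((μ[f * g|coarseSigma W β M]) U - (μ[f|coarseSigma W β M]) U * (μ[g|coarseSigma W β M]) U) ∂μ|
        ≤ ∫ U, |(μ[f * g|coarseSigma W β M]) U - (μ[f|coarseSigma W β M]) U * (μ[g|coarseSigma W β M]) U| ∂μ :=
          abs_integral_le_integral_abs
      _ ≤ c * Sf * Sg * Real.exp (-κ * n / W.factor β) := hmean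
      _ ≤ c₀ * Sf * Sg * Real.exp (-κ * n / W.factor β) :=
          mul_le_mul_of_nonneg_right (mul_le_mul_of_nonneg_right (mul_le_mul_of_nonneg_right hcc₀ hSf0) hSg0)
            (Real.exp_pos _).le
      _ ≤ c₀ * Sf * Sg * Real.exp (-m * n) :=
          mul_le_mul_of_nonneg_left hexp (mul_nonneg (mul_nonneg hc₀0 hSf0) hSg0)
  -- (3) quasi-locality at radius `R = ⌊n/(3b)⌋`, in-mean form (ii′)
  set R : ℕ := n / (3 * W.factor β) with hR
  obtain ⟨hf_, Δhf, δhf, hhfm, hhfd, hhfsub, ⟨Chf, hChf⟩, hhfl, hhfsum, hhfL1⟩ :=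
    hfl2 f Δf δf R hfm hfd ⟨Cf, hCf⟩ hfl'
  obtain ⟨hg_, Δhg, δhg, hhgm, hhgd, hhgsub, ⟨Chg, hChg⟩, hhgl, hhgsum, hhgL1⟩ :=
    hfl2 g Δg δg R hgm hgd ⟨Cg, hCg⟩ hgl
  -- names for the four random variables
  set F : GaugeConfig 3 (W.factor β * M) G → ℝ := μ[f|coarseSigma W β M] with hF
  set Gc : GaugeConfig 3 (W.factor β * M) G → ℝ := μ[g|coarseSigma W β M] with hGc
  set Hf : GaugeConfig 3 (W.factor β * M) G → ℝ := fun U => hf_ (W.blk β M U) with hHf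
  set Hg : GaugeConfig 3 (W.factor β * M) G → ℝ := fun U => hg_ (W.blk β M U) with hHg
  -- measurability / integrability / L² facts
  have hFm : AEStronglyMeasurable F μ := (stronglyMeasurable_condExp.mono hmle).aestronglyMeasurable
  have hGm : AEStronglyMeasurable Gc μ := (stronglyMeasurable_condExp.mono hmle).aestronglyMeasurable
  have hFb : ∀ᵐ U ∂μ, |F U| ≤ Cf := ae_bdd_abs_condExp_of_ae_bdd_abs (ae_of_all _ hCf)
  have hGb : ∀ᵐ U ∂μ, |Gc U| ≤ Cg := ae_bdd_abs_condExp_of_ae_bdd_abs (ae_of_all _ hCg)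
  have hF2 : MemLp F 2 μ := memLp_two_of_ae_bound hFm hFb
  have hG2 : MemLp Gc 2 μ := memLp_two_of_ae_bound hGm hGb
  have hHfmeas : Measurable Hf := hhfm.comp (W.measurable_blk β M)
  have hHgmeas : Measurable Hg := hhgm.comp (W.measurable_blk β M)
  have hHf2 : MemLp Hf 2 μ := memLp_two_of_bound hHfmeas (fun U => hChf _)
  have hHg2 : MemLp Hg 2 μ := memLp_two_of_bound hHgmeas (fun U => hChg _)
  have hDfi : Integrable (F - Hf) μ := (hF2.integrable one_le_two).sub (hHf2.integrable one_le_two)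
  have hDgi : Integrable (Gc - Hg) μ := (hG2.integrable one_le_two).sub (hHg2.integrable one_le_two)
  -- the decomposition `cov(F, G) = cov(F − Hf, G) + cov(Hf, G − Hg) + cov(Hf, Hg)`
  have hsplit : cov[F, Gc; μ] = cov[F - Hf, Gc; μ] + cov[Hf, Gc - Hg; μ] + cov[Hf, Hg; μ] := by
    rw [covariance_sub_left hF2 hHf2 hG2, covariance_sub_right hHf2 hG2 hHg2]; ring
  -- widths
  obtain ⟨U₀⟩ : Nonempty (GaugeConfig 3 (W.factor β * M) G) := ⟨fun _ => 1⟩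
  have hgI : ∀ U, g U₀ - D₀ * Sg ≤ g U ∧ g U ≤ g U₀ + D₀ * Sg := fun U => by
    have := mem_interval_of_isLipBound hD hgd hgl U₀ U; rwa [← hD₀] at this
  have hGI : ∀ᵐ U ∂μ, g U₀ - D₀ * Sg ≤ Gc U ∧ Gc U ≤ g U₀ + D₀ * Sg :=
    condExp_mem_Icc_ae hmle ((memLp_two_of_bound hgm hCg).integrable one_le_two) (ae_of_all _ hgI)
  have hHfI : ∀ U, hf_ (W.blk β M U₀) - D₀ * (c₀ * Sf) ≤ Hf U ∧ Hf U ≤ hf_ (W.blk β M U₀) + D₀ * (c₀ * Sf) := by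
    intro U
    have h := mem_interval_of_isLipBound hD hhfd hhfl (W.blk β M U₀) (W.blk β M U)
    rw [← hD₀] at h
    have hs : max D 0 * ∑ y ∈ Δhf, δhf y ≤ D₀ * (c₀ * Sf) := by
      rw [← hD₀]
      exact mul_le_mul_of_nonneg_left (hhfsum.trans (mul_le_mul_of_nonneg_right hcc₀ hSf0)) hD₀0
    exact ⟨by linarith [h.1], by linarith [h.2]⟩
  -- (3a) the cross term `cov(F − Hf, G)` from the L¹ bound on `F − Hf`
  have h3b : (0 : ℝ) < 3 * (W.factor β : ℝ) := by positivity
  have hR1 : (n : ℝ) / (3 * (W.factor β : ℝ)) - 1 ≤ (R : ℝ) := by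
    have h1 : n < (n / (3 * W.factor β) + 1) * (3 * W.factor β) := by
      rw [add_mul, one_mul]; exact Nat.lt_div_mul_add (by omega)
    have h2 : (n : ℝ) < ((R : ℝ) + 1) * (3 * (W.factor β : ℝ)) := by rw [hR]; exact_mod_cast h1
    have h3 : (n : ℝ) / (3 * (W.factor β : ℝ)) < (R : ℝ) + 1 := by rwa [div_lt_iff₀ h3b]
    linarith
  have hRle : (R : ℝ) ≤ (n : ℝ) / (3 * (W.factor β : ℝ)) := by
    rw [le_div_iff₀ h3b, hR]; exact_mod_cast Nat.div_mul_le_self n (3 * W.factor β)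
  have hmn3 : m * n ≤ min m_c κ * ((n : ℝ) / (3 * (W.factor β : ℝ))) := by
    have e : m * n = min m_c κ * ((n : ℝ) / (3 * (W.factor β : ℝ))) := by
      rw [hm_def]; field_simp
    rw [e]
  have hn3 : (0 : ℝ) ≤ (n : ℝ) / (3 * (W.factor β : ℝ)) := by positivity
  have hmkκ : m * n ≤ κ * ((n : ℝ) / (3 * (W.factor β : ℝ))) :=
    hmn3.trans (mul_le_mul_of_nonneg_right (min_le_right _ _) hn3)
  have hmkc : m * n ≤ m_c * ((n : ℝ) / (3 * (W.factor β : ℝ))) :=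
    hmn3.trans (mul_le_mul_of_nonneg_right (min_le_left _ _) hn3)
  have hexpR : Real.exp (-κ * R) ≤ Real.exp κ * Real.exp (-m * n) := by
    rw [← Real.exp_add]
    refine Real.exp_le_exp.2 ?_
    have := mul_le_mul_of_nonneg_left hR1 hκ
    linarith [hmkκ]
  have hT2 : |cov[F - Hf, Gc; μ]| ≤ 2 * (c₀ * Sf * (Real.exp κ * Real.exp (-m * n))) * (2 * (D₀ * Sg)) := by
    have hDf : ∫ U, |(F - Hf) U| ∂μ ≤ c₀ * Sf * (Real.exp κ * Real.exp (-m * n)) := by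
      calc ∫ U, |(F - Hf) U| ∂μ = ∫ U, |(μ[f|coarseSigma W β M]) U - hf_ (W.blk β M U)| ∂μ := rfl
        _ ≤ c * Sf * Real.exp (-κ * R) := hhfL1
        _ ≤ c₀ * Sf * Real.exp (-κ * R) :=
            mul_le_mul_of_nonneg_right (mul_le_mul_of_nonneg_right hcc₀ hSf0) (Real.exp_pos _).le
        _ ≤ c₀ * Sf * (Real.exp κ * Real.exp (-m * n)) := mul_le_mul_of_nonneg_left hexpR (mul_nonneg hc₀0 hSf0)
    have h := abs_covariance_le_of_integral_abs_le hDfi hGm hDf hGI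
    calc |cov[F - Hf, Gc; μ]| ≤ 2 * (c₀ * Sf * (Real.exp κ * Real.exp (-m * n))) *
          (g U₀ + D₀ * Sg - (g U₀ - D₀ * Sg)) := h
      _ = 2 * (c₀ * Sf * (Real.exp κ * Real.exp (-m * n))) * (2 * (D₀ * Sg)) := by ring
  -- (3b) the cross term `cov(Hf, G − Hg)` from the L¹ bound on `G − Hg`
  have hT3 : |cov[Hf, Gc - Hg; μ]| ≤ 2 * (c₀ * Sg * (Real.exp κ * Real.exp (-m * n))) * (2 * (D₀ * (c₀ * Sf))) := by
    have hDg : ∫ U, |(Gc - Hg) U| ∂μ ≤ c₀ * Sg * (Real.exp κ * Real.exp (-m * n)) := by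
      calc ∫ U, |(Gc - Hg) U| ∂μ = ∫ U, |(μ[g|coarseSigma W β M]) U - hg_ (W.blk β M U)| ∂μ := rfl
        _ ≤ c * Sg * Real.exp (-κ * R) := hhgL1
        _ ≤ c₀ * Sg * Real.exp (-κ * R) :=
            mul_le_mul_of_nonneg_right (mul_le_mul_of_nonneg_right hcc₀ hSg0) (Real.exp_pos _).le
        _ ≤ c₀ * Sg * (Real.exp κ * Real.exp (-m * n)) := mul_le_mul_of_nonneg_left hexpR (mul_nonneg hc₀0 hSg0)
    have h := abs_covariance_le_of_integral_abs_le hDgi hHfmeas.aestronglyMeasurable hDg (ae_of_all _ hHfI)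
    rw [covariance_comm] at h
    calc |cov[Hf, Gc - Hg; μ]| ≤ 2 * (c₀ * Sg * (Real.exp κ * Real.exp (-m * n))) *
          (hf_ (W.blk β M U₀) + D₀ * (c₀ * Sf) - (hf_ (W.blk β M U₀) - D₀ * (c₀ * Sf))) := h
      _ = 2 * (c₀ * Sg * (Real.exp κ * Real.exp (-m * n))) * (2 * (D₀ * (c₀ * Sf))) := by ring
  -- (4) the main term: push forward to the coarse law
  have hmap : cov[Hf, Hg; μ] = cov[hf_, hg_; coarseFamily ρ β W M] := by
    have e : coarseFamily ρ β W M = μ.map (W.blk β M) := rfl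
    rw [e, covariance_map hhfm.aestronglyMeasurable hhgm.aestronglyMeasurable (W.measurable_blk β M).aemeasurable]
    rfl
  -- coarse separation
  set nc : ℕ := (n + 1) / W.factor β - (2 * R + 1) with hnc
  have hsep : ∀ y ∈ Δhf, ∀ y' ∈ Δhg, nc ≤ torusNorm (y.1 - y'.1) := by
    intro y hy y' hy'
    obtain ⟨x, hx, hxR⟩ := hhfsub (Finset.mem_coe.2 hy)
    obtain ⟨x', hx', hx'R⟩ := hhgsub (Finset.mem_coe.2 hy')
    have key := le_blockSeparation hb (hdist x hx x' hx') hxR hx'R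
    have hb1 : 1 ≤ W.factor β := hb
    have h1 : n + 1 ≤ W.factor β * (torusNorm (y.1 - y'.1) + 2 * R + 1) := by
      zify [hb1] at key ⊢
      linarith
    have h2 : (n + 1) / W.factor β ≤ torusNorm (y.1 - y'.1) + 2 * R + 1 := Nat.div_le_of_le_mul h1
    rw [hnc]
    generalize (n + 1) / W.factor β = q at h2 ⊢
    omega
  have hT4 : |cov[Hf, Hg; μ]| ≤ A₀ * (c₀ * Sf) * (c₀ * Sg) * (Real.exp (2 * m_c) * Real.exp (-m * n)) := by
    rw [hmap]
    have h := hcoarse hf_ hg_ Δhf Δhg δhf δhg nc hhfm hhgm hhfd hhgd ⟨Chf, hChf⟩ ⟨Chg, hChg⟩ hhfl hhgl hsep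
    have hShf0 : 0 ≤ ∑ y ∈ Δhf, δhf y := sum_nonneg fun y _ => hhfl.nonneg y
    have hShg0 : 0 ≤ ∑ y ∈ Δhg, δhg y := sum_nonneg fun y _ => hhgl.nonneg y
    have hShf : ∑ y ∈ Δhf, δhf y ≤ c₀ * Sf := hhfsum.trans (mul_le_mul_of_nonneg_right hcc₀ hSf0)
    have hShg : ∑ y ∈ Δhg, δhg y ≤ c₀ * Sg := hhgsum.trans (mul_le_mul_of_nonneg_right hcc₀ hSg0)
    -- the coarse rate: `m_c · nc ≥ m n − 2 m_c`
    have hexpc : Real.exp (-m_c * nc) ≤ Real.exp (2 * m_c) * Real.exp (-m * n) := by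
      rw [← Real.exp_add]
      refine Real.exp_le_exp.2 ?_
      have hq : ((n : ℝ) + 1) / (W.factor β : ℝ) - 1 ≤ (((n + 1) / W.factor β : ℕ) : ℝ) := by
        have h1 : n + 1 < ((n + 1) / W.factor β + 1) * W.factor β := by
          rw [add_mul, one_mul]; exact Nat.lt_div_mul_add hb
        have h2 : ((n : ℝ) + 1) < ((((n + 1) / W.factor β : ℕ) : ℝ) + 1) * (W.factor β : ℝ) := by
          exact_mod_cast h1
        have h3 : ((n : ℝ) + 1) / (W.factor β : ℝ) < (((n + 1) / W.factor β : ℕ) : ℝ) + 1 := by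
          rwa [div_lt_iff₀ hbR]
        linarith
      have hsub : (((n + 1) / W.factor β : ℕ) : ℝ) - (2 * (R : ℝ) + 1) ≤ (nc : ℝ) := by
        have h0 := le_tsub_add (a := 2 * R + 1) (b := (n + 1) / W.factor β)
        have hcast : ((((n + 1) / W.factor β : ℕ)) : ℝ) ≤ (nc : ℝ) + (2 * (R : ℝ) + 1) := by
          rw [hnc]; exact_mod_cast h0
        linarith
      have hn1 : (n : ℝ) / (3 * (W.factor β : ℝ)) ≤
          ((n : ℝ) + 1) / (W.factor β : ℝ) - 2 * ((n : ℝ) / (3 * (W.factor β : ℝ))) := by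
        have e : ((n : ℝ) + 1) / (W.factor β : ℝ) = 3 * ((n : ℝ) / (3 * (W.factor β : ℝ))) + 1 / (W.factor β : ℝ) := by
          rw [← mul_div_assoc, mul_div_mul_left (n : ℝ) (W.factor β : ℝ) (by norm_num : (3 : ℝ) ≠ 0), add_div]
        rw [e]
        have h10 : (0 : ℝ) ≤ 1 / (W.factor β : ℝ) := by positivity
        linarith
      have hnc_ge : (n : ℝ) / (3 * (W.factor β : ℝ)) - 2 ≤ (nc : ℝ) := by linarith
      have := mul_le_mul_of_nonneg_left hnc_ge hmc
      linarith [hmkc]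
    have hE0 : 0 ≤ Real.exp (-m_c * (nc : ℝ)) := (Real.exp_pos _).le
    calc |cov[hf_, hg_; coarseFamily ρ β W M]|
        ≤ A_c * (∑ y ∈ Δhf, δhf y) * (∑ y ∈ Δhg, δhg y) * Real.exp (-m_c * nc) := h
      _ ≤ A₀ * (∑ y ∈ Δhf, δhf y) * (∑ y ∈ Δhg, δhg y) * Real.exp (-m_c * nc) :=
          mul_le_mul_of_nonneg_right (mul_le_mul_of_nonneg_right
            (mul_le_mul_of_nonneg_right (le_max_left _ _) hShf0) hShg0) hE0
      _ ≤ A₀ * (c₀ * Sf) * (c₀ * Sg) * Real.exp (-m_c * nc) := by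
          refine mul_le_mul_of_nonneg_right ?_ hE0
          exact mul_le_mul (mul_le_mul_of_nonneg_left hShf hA₀0) hShg hShg0
            (mul_nonneg hA₀0 (mul_nonneg hc₀0 hSf0))
      _ ≤ A₀ * (c₀ * Sf) * (c₀ * Sg) * (Real.exp (2 * m_c) * Real.exp (-m * n)) :=
          mul_le_mul_of_nonneg_left hexpc
            (mul_nonneg (mul_nonneg hA₀0 (mul_nonneg hc₀0 hSf0)) (mul_nonneg hc₀0 hSg0))
  -- (5) assemble
  calc |cov[f, g; μ]|
      = |(∫ U, ((μ[f * g|coarseSigma W β M]) U - (μ[f|coarseSigma W β M]) U * (μ[g|coarseSigma W β M]) U) ∂μ)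
          + cov[F, Gc; μ]| := by rw [hLTC]
    _ ≤ |∫ U, ((μ[f * g|coarseSigma W β M]) U - (μ[f|coarseSigma W β M]) U * (μ[g|coarseSigma W β M]) U) ∂μ|
          + |cov[F, Gc; μ]| := abs_add_le _ _
    _ ≤ c₀ * Sf * Sg * Real.exp (-m * n) + (|cov[F - Hf, Gc; μ]| + |cov[Hf, Gc - Hg; μ]| + |cov[Hf, Hg; μ]|) := by
          refine add_le_add hT1 ?_
          rw [hsplit]
          exact (abs_add_le _ _).trans (add_le_add (abs_add_le _ _) le_rfl)
    _ ≤ c₀ * Sf * Sg * Real.exp (-m * n) +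
          (2 * (c₀ * Sf * (Real.exp κ * Real.exp (-m * n))) * (2 * (D₀ * Sg)) +
            2 * (c₀ * Sg * (Real.exp κ * Real.exp (-m * n))) * (2 * (D₀ * (c₀ * Sf))) +
            A₀ * (c₀ * Sf) * (c₀ * Sg) * (Real.exp (2 * m_c) * Real.exp (-m * n))) :=
          add_le_add le_rfl (add_le_add (add_le_add hT2 hT3) hT4)
    _ = (c₀ + 4 * c₀ * D₀ * Real.exp κ * (1 + c₀) + A₀ * c₀ ^ 2 * Real.exp (2 * m_c)) * Sf * Sg *
          Real.exp (-m * n) := by ring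
    _ = (c₀ + 4 * c₀ * D₀ * Real.exp κ * (1 + c₀) + A₀ * c₀ ^ 2 * Real.exp (2 * m_c)) *
          (∑ x ∈ Δf, δf x) * (∑ y ∈ Δg, δg y) * Real.exp (-(min m_c κ / (3 * W.factor β)) * n) := by
          rw [hSf, hSg, hm_def]

/-- **A.s. ⟹ in-mean (the generalisation claim, checked):** on a probability-or-zero fine law, the almost-sure
clause-(i) bound of `FluctuationDecouplingAt` implies the integrated clause-(i′) bound with constant `max c 0`
(and likewise for clause (ii), same one-line argument; packaged in `InMean.lean`). [folklore] -/
theorem integral_abs_le_of_ae_abs_le {Ω : Type*} [MeasurableSpace Ω] {μ : Measure Ω}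
    (hP : IsProbabilityMeasure μ ∨ μ = 0) {X : Ω → ℝ} {K : ℝ} (hK : 0 ≤ K) (h : ∀ᵐ ω ∂μ, |X ω| ≤ K) :
    ∫ ω, |X ω| ∂μ ≤ K := by
  rcases hP with hμ | rfl
  · calc ∫ ω, |X ω| ∂μ ≤ ∫ _, K ∂μ :=
          integral_mono_of_nonneg (Eventually.of_forall fun _ => abs_nonneg _) (integrable_const K) h
        _ = K := by simp
  · simp [hK]

end Main

end Summit.Ventures.YMGap.YM3IR.DecayTransferInMean

end
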